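import Mathlib.Analysis.Calculus.Deriv.MeanValue
import Mathlib.Analysis.Normed.Operator.Bilinear
import Mathlib.Analysis.InnerProductSpace.PiL2
import Literature.Geometry.Lorentzian.Basic
import HarnessLib

/-!
# `SegmentTimelike`: straight chart segments stay timelike and gain radius
(crux `GapExhaustion`, stmt-FinalStateConjecture-10808, line photon-shell-pseudoconvexity;
stub (E-2) `stub_segmentTimelike` of §1f ESCAPE)

§1f of the line joins every point of a radial band to the far zone by a chain of short straight
chart segments `s ↦ z + s • v` whose constant tangent `v` is timelike with margin at the start
(`G z v v ≤ -m`, `G` = metric components) and increases the radius function `f`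
(`df_z(v) ≥ ν`). This file is the generic calculus behind one link of the chain: if the components
`G` are `L₁`-Lipschitz and `df` is `L₂`-Lipschitz on a convex set `C` containing the segment,
`‖v‖ ≤ L`, and the parameter length `s` satisfies `s·L₁L³ ≤ m/2`, `s·L₂L² ≤ ν/2`, then the segment
stays timelike (`G (z + s • v) v v ≤ -m/2`) and gains radius at half rate
(`f z + s ν/2 ≤ f (z + s • v)`). Pure Mathlib (operator-norm bounds and the mean value
inequality `Convex.mul_sub_le_image_sub_of_le_deriv`); no geometry. [folklore]
-/

noncomputable section

-- instance search through the nested operator types `E4 →L[ℝ] E4 →L[ℝ] ℝ`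
set_option maxSynthPendingDepth 3

-- D-0017: single-problem summit, `Summit.<S>.<S>.…` by design (cf. lakefile `weak.linter.dupNamespace`).
set_option linter.dupNamespace false

namespace Summit.FinalStateConjecture.FinalStateConjecture.Theorems

open Set Literature.Geometry.Lorentzian
open scoped Topology

/-- Displacement along a segment: for `t ∈ [0, s]` and `‖v‖ ≤ L`, `‖(z + t • v) - z‖ ≤ s L`.
[folklore] -/
private theorem segmentTimelike_norm_displacement_le (z v : E4) {L s t : ℝ} (hv : ‖v‖ ≤ L)
    (hs : 0 ≤ s) (ht : t ∈ Icc (0 : ℝ) s) : ‖(z + t • v) - z‖ ≤ s * L := by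
  rw [add_sub_cancel_left, norm_smul, Real.norm_eq_abs, abs_of_nonneg ht.1]
  exact mul_le_mul ht.2 hv (norm_nonneg _) hs

/-- Chain rule along a straight segment: if `f` is differentiable at `z + t • v` then
`t' ↦ f (z + t' • v)` has derivative `df_{z + t • v}(v)` at `t`. [folklore] -/
private theorem segmentTimelike_hasDerivAt_comp_segment (f : E4 → ℝ) (z v : E4) (t : ℝ)
    (hf : DifferentiableAt ℝ f (z + t • v)) :
    HasDerivAt (fun t' : ℝ => f (z + t' • v)) (fderiv ℝ f (z + t • v) v) t := by
  have hlin : HasDerivAt (fun t' : ℝ => z + t' • v) v t := by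
    simpa using ((hasDerivAt_id t).smul_const v).const_add z
  exact hf.hasFDerivAt.comp_hasDerivAt t hlin

/-- **(E-2) Straight chart segments stay timelike and gain radius.** Let `G : E4 → (E4 →L E4 →L ℝ)`
be `L₁`-Lipschitz and `f : E4 → ℝ` differentiable with `df` `L₂`-Lipschitz on a convex set `C`.
If `‖v‖ ≤ L`, `G z v v ≤ -m`, `ν ≤ df_z(v)`, `0 ≤ s`, `s L₁ L³ ≤ m/2`, `s L₂ L² ≤ ν/2` and the
segment `z + [0, s] • v` lies in `C`, then `G (z + s • v) v v ≤ -m/2` and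
`f z + s ν / 2 ≤ f (z + s • v)`. Proof: (i) `|G (z+sv) v v - G z v v| ≤ ‖G (z+sv) - G z‖ ‖v‖² ≤
L₁ (s L) L² ≤ m/2`; (ii) `φ t := f (z + t • v)` has `φ' t = df_{z+tv}(v) ≥ ν - L₂ (s L) L ≥ ν/2`
on `[0, s]`, and the mean value inequality gives `φ s - φ 0 ≥ s ν/2`. [folklore] -/
theorem stub_segmentTimelike :
    ∀ (G : E4 → E4 →L[ℝ] E4 →L[ℝ] ℝ) (f : E4 → ℝ) (C : Set E4) (L₁ L₂ L m ν : ℝ),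
      Convex ℝ C → 0 ≤ L₁ → 0 ≤ L₂ → 0 < L → 0 < m → 0 < ν →
      (∀ x ∈ C, ∀ y ∈ C, ‖G x - G y‖ ≤ L₁ * ‖x - y‖) →
      (∀ x ∈ C, DifferentiableAt ℝ f x) →
      (∀ x ∈ C, ∀ y ∈ C, ‖fderiv ℝ f x - fderiv ℝ f y‖ ≤ L₂ * ‖x - y‖) →
      ∀ (z v : E4) (s : ℝ), ‖v‖ ≤ L → G z v v ≤ -m → ν ≤ fderiv ℝ f z v → 0 ≤ s →
        s * (L₁ * L ^ 3) ≤ m / 2 → s * (L₂ * L ^ 2) ≤ ν / 2 →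
        (∀ s' ∈ Icc (0 : ℝ) s, z + s' • v ∈ C) →
        G (z + s • v) v v ≤ -(m / 2) ∧ f z + s * (ν / 2) ≤ f (z + s • v) := by
  intro G f C L₁ L₂ L m ν _hC hL₁ hL₂ _hL _hm _hν hG hf hdf z v s hv hGz hdfz hs hs₁ hs₂ hseg
  -- both endpoints (indeed the whole segment) lie in `C`
  have hzC : z ∈ C := by simpa using hseg 0 ⟨le_rfl, hs⟩
  have hsC : z + s • v ∈ C := hseg s ⟨hs, le_rfl⟩
  refine ⟨?_, ?_⟩
  · -- (i) the quadratic form moves by at most `L₁ (s L) L L ≤ m / 2`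
    have h1 : ‖G (z + s • v) - G z‖ ≤ L₁ * (s * L) :=
      (hG _ hsC _ hzC).trans (mul_le_mul_of_nonneg_left
        (segmentTimelike_norm_displacement_le z v hv hs ⟨hs, le_rfl⟩) hL₁)
    have h2 : ‖(G (z + s • v) - G z) v v‖ ≤ L₁ * (s * L) * L * L :=
      (G (z + s • v) - G z).le_of_opNorm₂_le_of_le h1 hv hv
    rw [Real.norm_eq_abs, abs_le] at h2
    simp only [sub_apply] at h2
    have h4 : L₁ * (s * L) * L * L = s * (L₁ * L ^ 3) := by ring
    rw [h4] at h2
    linarith [h2.2]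
  · -- (ii) `φ t := f (z + t • v)` has derivative `≥ ν / 2` on `[0, s]`; mean value inequality
    have hderiv : ∀ t ∈ Icc (0 : ℝ) s,
        HasDerivAt (fun t' : ℝ => f (z + t' • v)) (fderiv ℝ f (z + t • v) v) t :=
      fun t ht => segmentTimelike_hasDerivAt_comp_segment f z v t (hf _ (hseg t ht))
    have hbound : ∀ t ∈ Icc (0 : ℝ) s, ν / 2 ≤ fderiv ℝ f (z + t • v) v := by
      intro t ht
      have h1 : ‖fderiv ℝ f (z + t • v) - fderiv ℝ f z‖ ≤ L₂ * (s * L) :=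
        (hdf _ (hseg t ht) _ hzC).trans (mul_le_mul_of_nonneg_left
          (segmentTimelike_norm_displacement_le z v hv hs ht) hL₂)
      have h2 : ‖(fderiv ℝ f (z + t • v) - fderiv ℝ f z) v‖ ≤ L₂ * (s * L) * L :=
        (fderiv ℝ f (z + t • v) - fderiv ℝ f z).le_of_opNorm_le_of_le h1 hv
      rw [Real.norm_eq_abs, abs_le] at h2
      simp only [sub_apply] at h2
      have h4 : L₂ * (s * L) * L = s * (L₂ * L ^ 2) := by ring
      rw [h4] at h2
      linarith [h2.1]
    have hcont : ContinuousOn (fun t' : ℝ => f (z + t' • v)) (Icc 0 s) :=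
      fun t ht => (hderiv t ht).continuousAt.continuousWithinAt
    have hdiff : DifferentiableOn ℝ (fun t' : ℝ => f (z + t' • v)) (interior (Icc 0 s)) := by
      rw [interior_Icc]
      exact fun t ht => (hderiv t (Ioo_subset_Icc_self ht)).differentiableAt.differentiableWithinAt
    have hge : ∀ t ∈ interior (Icc (0 : ℝ) s), ν / 2 ≤ deriv (fun t' : ℝ => f (z + t' • v)) t := by
      rw [interior_Icc]
      intro t ht
      rw [(hderiv t (Ioo_subset_Icc_self ht)).deriv]
      exact hbound t (Ioo_subset_Icc_self ht)
    have hmvt := (convex_Icc (0 : ℝ) s).mul_sub_le_image_sub_of_le_deriv hcont hdiff hge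
      0 (left_mem_Icc.2 hs) s (right_mem_Icc.2 hs) hs
    simp only [zero_smul, add_zero, sub_zero] at hmvt
    linarith

end Summit.FinalStateConjecture.FinalStateConjecture.Theorems

end
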